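import Summits.SmoothPoincare4.SmoothPoincare4.Theorems.InformationMetricHadamardAhHadamardFillingFisherSphereGaussDefs
import Summits.SmoothPoincare4.SmoothPoincare4.Theorems.InformationMetricHadamardAhHadamardFillingStubCollarEndHadamard
import Summits.SmoothPoincare4.SmoothPoincare4.Theorems.InformationMetricHadamardAhHadamardFillingStubFisherRaoMetric
import Summits.SmoothPoincare4.SmoothPoincare4.Theorems.InformationMetricHadamardAhHadamardFillingStubHellingerGaussEquationFamilies
import Summits.SmoothPoincare4.SmoothPoincare4.Theorems.InformationMetricHadamardAhHadamardFillingStubHellingerGaussEquationImmersion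
import Summits.SmoothPoincare4.SmoothPoincare4.Theorems.InformationMetricHadamardAhHadamardFillingStubHellingerGaussEquation
import Summits.SmoothPoincare4.SmoothPoincare4.Theorems.InformationMetricHadamardAhHadamardFillingStubInstantonCollarPackage

/-!
# Line `fisher-sphere-gauss` — skeleton for crux `InformationMetricHadamard.AhHadamardFilling`

(item stmt-SmoothPoincare4-6014, route `InformationMetricHadamard`, rank 2; idea cards
`Cruxes/AhHadamardFilling/Ideas/fisher-sphere-gauss.md` (ideator 1) MERGED, as both triagers asked,
with `Ideas/hellinger-gauss-normal-part.md` (ideator 2) — same lever — and carrying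
`Ideas/universal-cover-strips-topology.md` as its topology component; triage `TRIAGE-r1-1.md`,
`TRIAGE-r1-2.md` (pass ×2); crux-plan by `planner-cruxplan-stmt-SmoothPoincare4-6014-fisher-sphere-gauss-0`,
2026-08-16.)

Crux (fixed, never restated): every homotopy 4-sphere `Σ` carries a Riemannian metric `g` and is the
cross-section of a proper end collar `Φ : Σ × (0,1) → W` of a Cartan–Hadamard 5-manifold `(W, G)`
(complete, simply connected, `sec ≤ 0`) on which `G` is `C⁰`-asymptotic to `c (dλ² + g)/λ²`.

## The line: the information metric is an INDUCED metric — Gauss equation of the Hellinger map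

Witness: `W` = a smooth model of the collar component of the charge-one instanton moduli space
`M₁(Σ, g) = Literature.Geometry.GaugeTheory.AsdModuliSpace g Σ.orientation 1` (typed carrier in the
tree), `G` = Hitchin's information metric `g_I(a,b) = ∫ δ_aρ δ_bρ / ρ dvol_g` of the curvature
densities `ρ_A = |F_A|²_g` (tree: `AsdModuliSpace.density`). The LEVER (cards 3 ≈ 5): with the
Hellinger (square-root) map `θ : [A] ↦ 2√ρ_A ∈ L²(Σ, dvol_g)` one has `g_I = θ^*⟨·,·⟩_{L²}` — an
induced metric of a map into flat Hilbert space (landing in the round sphere of radius `2√(8π²)`,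
since `∫ ρ_A = 8π²`) — so the GAUSS EQUATION computes its curvature from the normal part `II` of the
chart Hessian of `θ` alone:

  `Rm_{g_I}(X, Y, Y, X) = ⟨II(X,X), II(Y,Y)⟩_{L²} − ‖II(X,Y)‖²_{L²}`,

and `sec(g_I) ≤ 0` everywhere ⇔ SADDLE DOMINANCE `‖II(X,Y)‖² ≥ ⟨II(X,X), II(Y,Y)⟩` at every point —
Groisser–Murray's missing curvature formula (dg-ga/9611008 p. 5) in closed form. (In the sphere of
radius `R = 2√(8π²)` the same inequality reads `‖II^S(X,Y)‖² − ⟨II^S(X,X),II^S(Y,Y)⟩ ≥ area²/R²`,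
`1/R² = 1/(32π²)` — the cards' form; the flat form typed below absorbs the radial component
`−(G(X,Y)/R²) θ` of `II` and needs no mass identity.) Anchor: on round `S⁴`, `θ` is a Takahashi-minimal
`SO(5,1)`-equivariant immersion of `ℍ⁵`, Schur on `S²₀ℝ⁵` gives Gauss term `−9/(128π²)`, total
`−5/(128π²)` = Hitchin's constant (both triagers re-derived the arithmetic).

Vocabulary (§ Vocabulary, plain `def`s with explicit parameters over tree/Mathlib declarations; nothing
is asserted, no closed proposition is defined; to be moved verbatim into
`Theorems/InformationMetricHadamardAhHadamardFillingFisherSphereGaussDefs.lean` by the lead so that landed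
stub files can import it): `chartFamily`/`D1`/`D2` (chart representative of a family `θ : W → N → ℝ` at
the base point `w` and its first/second parameter derivatives — `D1 θ w X x = mfderiv (θ · x) w X`),
`gIntegral` (integral against `dvol_g`), `fisherForm` (`𝓘_θ(w)(X,Y) = ∫ D1θ X · D1θ Y`; for
`θ = 2√ρ` this IS `g_I`, GM (metric1)), `IsNormalPart` (`h = II(X,Y)`: `D2θ(X,Y) − h` tangential and
`h ⊥` tangent space in `L²`), `saddleForm` (`‖h_XY‖² − ⟨h_XX, h_YY⟩`), `hellinger ι` (`w ↦ 2√ρ_{ι w}`),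
`IsModuliModel ι` (`ι : W → M₁(Σ,g)` is an open embedding with closed range containing every
sufficiently concentrated class — i.e. `W` is a smooth model of the collar component(s) — on which
the universal density `(w, x) ↦ ρ_{ι w}(x)` is jointly smooth).

Registered stubs (5):

* `stub_coreSaddleDominance` (APEX; open-problem/XL; HARDEST; cards 3 K1 = 5 K1 = 4 K1 "CORE SIGN",
  with the interior nondegeneracy (N) of informal item 7336 and the choice of the conformal class):
  for every homotopy 4-sphere `Σ` there are a Riemannian `g` and a smooth connected model
  `ι : W → M₁(Σ,g)` of the collar component (for Freed–Uhlenbeck-generic `g` the Kuranishi structure is one) with `ρ > 0` on `W × Σ`, `g_I`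
  positive definite on `W`, and saddle dominance of the Hellinger second fundamental form at every
  point of `W`. SPC4-STRENGTH by the tame-witness dichotomy (triage C2; inherent to the crux, declared):
  any proof yields `Σ ≅ S⁴` via crux 3. Not an abstract `∃W`: the witness is pinned to the canonical
  object, the inequality is evaluable instanton-by-instanton, and it can FAIL while SPC4 holds (kill
  criterion (i) of the route) — its finite falsifiers are in the line card.
* `stub_instantonCollarPackage` (F; XL to formalise, KNOWN: Taubes 1982, Uhlenbeck 1982, Donaldson 1983
  §§III–IV, Freed–Uhlenbeck 1984, Atiyah–Hitchin–Singer 1978, Groisser–Murray 1997 Thm 3.1): on any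
  such model the Donaldson–Taubes collar `Φ : Σ × (0,1) → W` exists — smooth, injective, co-compact in
  `W`, closure clause — and `g_I` is `C⁰`-asymptotic to `c (dλ² + g)/λ²` along it (`c = 128π²/5` for
  GM's scale; `∃ c` absorbs normalisations). Model-independence on the end is part of the stub (the
  Hellinger map is an immersion there for every admissible model, GM's collar nondegeneracy).
* `stub_fisherRaoMetric` (I; M–L; the route's definition request D1 turned into a lemma): the Fisher
  form of a jointly smooth family `θ : W → C^∞(N)` with `𝓘_θ` positive definite is a smooth Riemannian
  `PseudoRiemannianMetric` `G` on `W` with `G.val = 𝓘_θ` (differentiation under `∫` over compact `N`).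
* `stub_hellingerGaussEquation` (K2; L; the INSTRUMENT; Gauss 1827 / Lee RM Thm 8.5 for an immersion
  into the flat Hilbert space `L²(N, dvol)`): for such `θ`, `G` and any Levi-Civita `cov` of `G`,
  at every `w, X, Y` the normal parts `h_XX, h_XY, h_YY` of the chart Hessian exist and
  `Rm(X,Y,Y,X) = ⟨h_XX,h_YY⟩ − ‖h_XY‖² = −saddleForm`.
* `stub_collarEndHadamard` (T; L; card `universal-cover-strips-topology`, re-derived clause by clause
  by both triagers; provable NOW from `Literature.Geometry.Riemannian.HadamardExpCovering`,
  `…CoveringSubsingletonFiber`, landed far-collar lemmas p110749/p112347): a CONNECTED Riemannian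
  5-manifold with `sec ≤ 0` carrying a co-compact `C⁰`-conical `Σ`-collar (the crux's clauses
  verbatim) is complete (closed balls compact: far-is-far + co-compactness) and simply connected
  (ℝ⁵ has one end: two disjoint open sets with compact frontier and non-compact closure cannot
  coexist, so the collar has one lift to the universal cover `exp_p : ℝ⁵ → W`).

Proved here (no `sorry` of its own): `AhHadamardFilling_of` — the crux BY NAME: apex ↦ `(g, W, ι)`;
I ↦ `G = g_I`; F ↦ `(c, Φ)` and the collar/asymptotic clauses (rewritten from `𝓘` to `G.val`);
K2 + apex ↦ `Rm(X,Y,Y,X) ≤ 0`, Cauchy–Schwarz for `G_w` ↦ `sec ≤ 0` in the tree's normalisation;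
T ↦ completeness and `SimplyConnectedSpace W`.

## Disproof.lean / Negative side honoured

No `Disproof.lean` is published for this crux (`ledger crux ls stmt-SmoothPoincare4-6014`,
2026-08-16T19:40Z; payload `disproof_path` does not resolve). Landed Negative lemmas
(`Theorems/AhHadamardFilling/Negative/`): `ahHadamardFilling_of_smoothPoincare4` (p119273),
`tameFillingNoPi1_of_smoothPoincare4` (p119659), `tameFillingNoPi1_iff_smoothPoincare4` /
`ahHadamardFilling_iff_smoothPoincare4_of_c0AhRecognition` (p121624). None refutes a stub here: F, I,
K2, T are theorems of the literature / of Riemannian geometry with no SPC4 content; the apex is not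
`TameFillingNoPi1` or any abstract `∃W` statement (dead line `Sketch`, L5(iii)) — its `W` is pinned to
`AsdModuliSpace g Σ.orientation 1` by `IsModuliModel` and its metric to `density` by `hellinger`, and
`SmoothPoincare4 → apex` is NOT pure logic (it needs the ADHM/AHS description of `M₁(S⁴, round)` and
the anchor computation), while `apex → SmoothPoincare4` goes through this skeleton and crux 3.
`ledger negatives --problem SmoothPoincare4`: checked at plan time (see line card).
-/

noncomputable section

-- the prescribed namespace `Summit.<P>.<Sub>.…` duplicates `SmoothPoincare4` (P = Sub)
set_option linter.dupNamespace false

open scoped Manifold ContDiff Topology ENNReal NNReal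
open Set Function MeasureTheory Topology

namespace Summit.SmoothPoincare4.SmoothPoincare4.Cruxes.AhHadamardFilling.FisherSphereGauss

open Literature.Topology.FourManifolds (HomotopySphere)
open Literature.Geometry.Lorentzian (PseudoRiemannianMetric riemannianMeasure)
open Literature.Geometry.GaugeTheory (AsdModuliSpace)

/-! ## Landed pieces of the line (leads c3, c5; 2026-08-16)

* Vocabulary (`chartFamily`, `D1`, `D2`, `gIntegral`, `fisherForm`, `IsNormalPart`, `saddleForm`,
  `hellinger`, `IsModuliModel`) — `Theorems/InformationMetricHadamardAhHadamardFillingFisherSphereGaussDefs.lean` (p125927);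
* T `stub_collarEndHadamard` — `…StubCollarEndHadamard.lean` (p126043);
* I `stub_fisherRaoMetric` — `…StubFisherRaoMetric.lean` (p126918);
* K2 `stub_hellingerGaussEquation` — helpers `…StubHellingerGaussEquationFamilies.lean` (p127000),
  `…StubHellingerGaussEquationImmersion.lean` (p127007: `val_curvature_immersion`, the Gauss equation of an isometric
  immersion into a flat inner product space), `…StubHellingerGaussEquationLpFamily.lean` (p128931) and the stub
  `…StubHellingerGaussEquation.lean` (p129087, lead c5 wave 1).
* F `stub_instantonCollarPackage` — RESHAPED r2-c5 into the cited fact (stub GM below) + the landed transfer: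
  `…StubInstantonCollarPackageTopology.lean` (p129916), `…ImmersionTransfer.lean` (p129669),
  `…LpFamily.lean` (p130239), `…Smooth.lean` (p130685), `…Asymptotics.lean` (p131421), assembled in
  `…StubInstantonCollarPackage.lean` (`stub_instantonCollarPackage_of`); Literature fact
  `Literature.Geometry.GaugeTheory.informationMetric_collarAsymptotics` (p130424).
Open: APEX `stub_coreSaddleDominance` (SPC4-strength), GM `stub_informationMetricCollarAsymptotics` (cited fact, XL debt). -/

/-! ## Stub APEX — core saddle dominance of the Hellinger map of `M₁(Σ, [g])` (HARDEST) -/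

/-- **APEX (`coreSaddleDominance`; cards fisher-sphere-gauss K1 = hellinger-gauss-normal-part K1 =
universal-cover-strips-topology K1 "CORE SIGN", together with the interior nondegeneracy (N) of the
information metric and the choice of the conformal class — the typed form of the interior content of
informal item stmt-SmoothPoincare4-7336).** For every homotopy 4-sphere `Σ` there is a Riemannian
metric `g` and a smooth connected model `ι : W → M₁(Σ, g)` of the collar component (`IsModuliModel`;
for Freed–Uhlenbeck-generic `g` — a dense set, Freed–Uhlenbeck 1984 Ch. 3 — the Kuranishi structure of
`M₁ = M₁^*` is such a model, and only smoothness of that component is implicitly asked) on which: the densities have no zeros (`ρ_{ι w}(x) > 0`, so the Hellinger map is smooth),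
the information form `g_I = 𝓘_{2√ρ}` is positive definite (GM 1997 §2: nondegenerate on the collar,
"plausible for generic metrics" inside), and the second fundamental form of the Hellinger map is
SADDLE-DOMINATED at every point: `‖II(X,Y)‖² ≥ ⟨II(X,X), II(Y,Y)⟩` for all `X, Y` (flat form; in the
sphere of radius `2√(8π²)`: saddle excess `≥ area²/(32π²)`). Anchor: round `S⁴`, `M₁ = ℍ⁵`, Gauss term
`−9/(128π²)·area²` against `+4/(128π²)·area²` (Takahashi minimality + `SO(5)`-Schur). SPC4-STRENGTH
(tame-witness dichotomy): declared, inherent to the crux. Why it might fail off the round class: no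
mechanism forces the inequality; GM Thm 5.1 (`ℂP²` cone point) and kit j017439 (`M₂(S⁴)`:
breathing–breathing planes `K > 0`) show the sign is not structural for information metrics.
Reshape r2-c5 (lead c5): the chosen `g` is also asked to be Freed–Uhlenbeck generic
(`IsFreedUhlenbeckGeneric g Σ.orientation 1`: every irreducible `g`-ASD connection on `P₁` is regular —
Groisser–Murray's standing assumption, true for the round metric at the anchor, where every
charge-one instanton is BPST and regular), so that the cited collar/asymptotics fact applies.
[cite: GroisserMurray1997, §2 p. 5, Thm 5.1; Hitchin1990; BlauNarainThompson2001 §4] -/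
theorem stub_coreSaddleDominance (S : HomotopySphere 4) [Nonempty S.carrier] :
    ∃ (g : PseudoRiemannianMetric (𝓡 4) ∞ (EuclideanSpace ℝ (Fin 4)) (TangentSpace (𝓡 4) : S.carrier → Type _))
      (hg : g.IsRiemannian)
      (W : Type) (_ : TopologicalSpace W) (_ : T2Space W) (_ : SecondCountableTopology W)
        (_ : ChartedSpace (EuclideanSpace ℝ (Fin 5)) W) (_ : IsManifold (𝓡 5) ∞ W) (_ : ConnectedSpace W)
        (ι : W → AsdModuliSpace g S.orientation 1),
        Literature.Geometry.GaugeTheory.IsFreedUhlenbeckGeneric g S.orientation 1 ∧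
        IsModuliModel ι ∧
        (∀ (w : W) (x : S.carrier), 0 < (ι w).density g x) ∧
        (∀ (w : W) (X : EuclideanSpace ℝ (Fin 5)), X ≠ 0 → 0 < fisherForm g hg (hellinger ι) w X X) ∧
        (∀ (w : W) (X Y : EuclideanSpace ℝ (Fin 5)) (hXX hXY hYY : S.carrier → ℝ),
          IsNormalPart g hg (hellinger ι) w X X hXX → IsNormalPart g hg (hellinger ι) w X Y hXY →
          IsNormalPart g hg (hellinger ι) w Y Y hYY → 0 ≤ saddleForm g hg hXX hXY hYY) := by
  sorry

/-! ## Stub GM — the cited gauge-theory input (Groisser–Murray Thm 3.1 on the Donaldson–Taubes collar) -/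

/-- **GM (`informationMetricCollarAsymptotics`; reshape r2-c5 of stub F).** The one published
input of the line that the tree states but does not yet prove: the Literature fact
`Literature.Geometry.GaugeTheory.informationMetric_collarAsymptotics` (landed p130424) — for a
homotopy 4-sphere `Σ` and a Riemannian `g` with every irreducible `g`-ASD connection on `P₁`
regular, the charge-one moduli space `M₁(Σ, g) = AsdModuliSpace g Σ.orientation 1` has a
Donaldson–Taubes collar `Ψ : Σ × (0, λ₀) → M₁` (continuous, injective, co-compact far parts by
Uhlenbeck compactness, closure clause, jointly smooth concentrating curvature densities) along
which the information metric `∫ (∂ρ)²/ρ dvol_g` is `C⁰`-asymptotic to `c (dλ² + g)/λ²`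
(Groisser–Murray 1997 Thm. 3.1; Donaldson 1983 §§III–IV; Freed–Uhlenbeck 1984 Chs. 8–9;
Uhlenbeck 1982). Discharging it (`…_holds`) is vendoring classical gauge theory (XL); it carries
no SPC4 content. With it, stub F is a THEOREM (`stub_instantonCollarPackage_of`, landed: the
transfer of the collar and of the asymptotics from `M₁` to any admissible model `W`).
[cite: GroisserMurray1997, Thm. 3.1] -/
theorem stub_informationMetricCollarAsymptotics :
    Literature.Geometry.GaugeTheory.informationMetric_collarAsymptotics := by
  sorry

/-! ## F — the instanton collar package, now PROVED from stub GM (transfer landed p129916,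
p130685, p131421; assembly `stub_instantonCollarPackage_of`) -/

/-- **F (`instantonCollarPackage`), proved form.** For a homotopy 4-sphere `Σ`, a Riemannian `g`
with `IsFreedUhlenbeckGeneric g Σ.orientation 1`, and a smooth connected model
`ι : W → M₁(Σ, g)` (`IsModuliModel`) with positive densities and positive-definite information
form, the Donaldson–Taubes collar exists IN `W` with all the crux's collar clauses and the
Groisser–Murray `C⁰` cone asymptotics of `𝓘 = fisherForm g hg (hellinger ι)` — from stub GM by
`stub_instantonCollarPackage_of`. [cite: GroisserMurray1997, Thm. 3.1] -/
theorem instantonCollarPackage (S : HomotopySphere 4) [Nonempty S.carrier]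
    (g : PseudoRiemannianMetric (𝓡 4) ∞ (EuclideanSpace ℝ (Fin 4)) (TangentSpace (𝓡 4) : S.carrier → Type _))
    (hg : g.IsRiemannian) (hgen : Literature.Geometry.GaugeTheory.IsFreedUhlenbeckGeneric g S.orientation 1)
    (W : Type) [TopologicalSpace W] [ChartedSpace (EuclideanSpace ℝ (Fin 5)) W]
    [IsManifold (𝓡 5) ∞ W] [ConnectedSpace W]
    (ι : W → AsdModuliSpace g S.orientation 1) (hι : IsModuliModel ι)
    (hρ : ∀ (w : W) (x : S.carrier), 0 < (ι w).density g x)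
    (hpos : ∀ (w : W) (X : EuclideanSpace ℝ (Fin 5)), X ≠ 0 → 0 < fisherForm g hg (hellinger ι) w X X) :
    ∃ (c : ℝ) (Φ : S.carrier × ℝ → W), 0 < c ∧
      ContMDiffOn ((𝓡 4).prod 𝓘(ℝ, ℝ)) (𝓡 5) ∞ Φ (univ ×ˢ Ioo (0 : ℝ) 1) ∧
      InjOn Φ (univ ×ˢ Ioo (0 : ℝ) 1) ∧
      (∀ t ∈ Ioo (0 : ℝ) 1, IsCompact (Φ '' (univ ×ˢ Ioo (0 : ℝ) t))ᶜ) ∧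
      (∀ t ∈ Ioo (0 : ℝ) 1, closure (Φ '' (univ ×ˢ Ioo (0 : ℝ) t)) ⊆ Φ '' (univ ×ˢ Ioo (0 : ℝ) 1)) ∧
      (∀ ε : ℝ, 0 < ε → ∃ t ∈ Ioo (0 : ℝ) 1, ∀ (x : S.carrier) (l : ℝ), l ∈ Ioo (0 : ℝ) t →
        ∀ (v : TangentSpace (𝓡 4) x) (s : ℝ),
          |fisherForm g hg (hellinger ι) (Φ (x, l))
                (mfderiv ((𝓡 4).prod 𝓘(ℝ, ℝ)) (𝓡 5) Φ (x, l) (v, s))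
                (mfderiv ((𝓡 4).prod 𝓘(ℝ, ℝ)) (𝓡 5) Φ (x, l) (v, s)) -
              c * (s ^ 2 + g.val x v v) / l ^ 2| ≤ ε * (c * (s ^ 2 + g.val x v v) / l ^ 2)) :=
  stub_instantonCollarPackage_of stub_informationMetricCollarAsymptotics S g hg hgen W ι hι hρ hpos

/-! ## The composition (kernel-checked; no `sorry` of its own) -/

/-- Cauchy–Schwarz for a positive semi-definite symmetric continuous bilinear form: the Gram
determinant of two vectors is non-negative (discriminant of `t ↦ B(X + tY, X + tY) ≥ 0`). Used to pass
from `Rm(X,Y,Y,X) ≤ 0` to the tree's normalised `sectionalCurvature ≤ 0`. [folklore] -/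
theorem gram_nonneg {V : Type*} [AddCommGroup V] [Module ℝ V] [TopologicalSpace V]
    (B : V →L[ℝ] V →L[ℝ] ℝ) (hsymm : ∀ v w, B v w = B w v) (hnn : ∀ v, 0 ≤ B v v) (X Y : V) :
    0 ≤ B X X * B Y Y - B X Y ^ 2 := by
  have hquad : ∀ t : ℝ, 0 ≤ B Y Y * (t * t) + (2 * B X Y) * t + B X X := by
    intro t
    have h := hnn (X + t • Y)
    have hexp : B (X + t • Y) (X + t • Y) = B Y Y * (t * t) + (2 * B X Y) * t + B X X := by
      simp only [map_add, map_smul, add_apply, FunLike.coe_smul, Pi.smul_apply, smul_eq_mul, hsymm Y X]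
      ring
    rw [hexp] at h
    exact h
  have hd := discrim_le_zero hquad
  rw [discrim] at hd
  nlinarith [hd]

/-- **Line `fisher-sphere-gauss` concludes the crux BY NAME.** For the given homotopy 4-sphere `Σ`:
the apex supplies the conformal class `g`, the smooth connected model `ι : W → M₁(Σ, g)` of the collar
component, positivity of the densities, nondegeneracy of `g_I` and saddle dominance; the Hellinger map
`θ = 2√ρ` is then jointly smooth; stub I realises `g_I` as a Riemannian `PseudoRiemannianMetric` `G`;
stub F supplies the Donaldson–Taubes collar `Φ`, the constant `c` and every collar / `C⁰`-asymptotic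
clause (stated for `𝓘`, rewritten to `G.val`); stub K2 (Gauss equation) with the apex's inequality gives
`Rm(X,Y,Y,X) ≤ 0`, and Cauchy–Schwarz for `G_w` gives `sec ≤ 0` in the tree's normalisation; stub T
turns connectedness + `sec ≤ 0` + the collar into completeness and simple connectivity. -/
theorem AhHadamardFilling_of :
    Summit.SmoothPoincare4.SmoothPoincare4.Theses.InformationMetricHadamard.AhHadamardFilling := by
  intro S
  -- the cross-section is nonempty (it is homotopy equivalent to `S⁴`)
  haveI : Nonempty S.carrier := by
    obtain ⟨e⟩ := S.nonempty_homotopyEquiv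
    obtain ⟨p, hp⟩ : (Metric.sphere (0 : EuclideanSpace ℝ (Fin 5)) 1).Nonempty :=
      NormedSpace.sphere_nonempty.2 zero_le_one
    exact ⟨e.invFun ⟨p, hp⟩⟩
  -- APEX: conformal class, model of the collar component, positivity, nondegeneracy, saddle dominance
  obtain ⟨g, hg, W, i₁, i₂, i₃, i₄, i₅, i₆, ι, hgen, hmod, hρ, hpos, hSD⟩ := stub_coreSaddleDominance S
  -- the Hellinger map is jointly smooth (`√` is smooth on `(0, ∞)`)
  have hθ : ContMDiff ((𝓡 5).prod (𝓡 4)) 𝓘(ℝ, ℝ) ∞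
      (fun p : W × S.carrier ↦ hellinger ι p.1 p.2) := by
    intro p
    have hρs : ContMDiffAt ((𝓡 5).prod (𝓡 4)) 𝓘(ℝ, ℝ) ∞
        (fun q : W × S.carrier ↦ (ι q.1).density g q.2) p := hmod.2.2.2 p
    have h2 : ContDiffAt ℝ ∞ (fun r : ℝ ↦ 2 * Real.sqrt r) ((ι p.1).density g p.2) :=
      contDiffAt_const.mul (Real.contDiffAt_sqrt (hρ p.1 p.2).ne')
    exact h2.comp_contMDiffAt (f := fun q : W × S.carrier ↦ (ι q.1).density g q.2) hρs
  -- I: the information metric as a Riemannian `PseudoRiemannianMetric`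
  obtain ⟨G, hG, hGval⟩ := stub_fisherRaoMetric S.carrier g hg W (hellinger ι) hθ hpos
  -- F: the Donaldson–Taubes collar and the Groisser–Murray asymptotics
  obtain ⟨c, Φ, hc, hsm, hinj, hco, hcl, hasymI⟩ :=
    instantonCollarPackage S g hg hgen W ι hmod hρ hpos
  have hasym : ∀ ε : ℝ, 0 < ε → ∃ t ∈ Ioo (0 : ℝ) 1, ∀ (x : S.carrier) (l : ℝ), l ∈ Ioo (0 : ℝ) t →
      ∀ (v : TangentSpace (𝓡 4) x) (s : ℝ),
        |G.val (Φ (x, l)) (mfderiv ((𝓡 4).prod 𝓘(ℝ, ℝ)) (𝓡 5) Φ (x, l) (v, s))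
            (mfderiv ((𝓡 4).prod 𝓘(ℝ, ℝ)) (𝓡 5) Φ (x, l) (v, s)) -
          c * (s ^ 2 + g.val x v v) / l ^ 2| ≤ ε * (c * (s ^ 2 + g.val x v v) / l ^ 2) := by
    intro ε hε
    obtain ⟨t, ht, h⟩ := hasymI ε hε
    refine ⟨t, ht, fun x l hl v s ↦ ?_⟩
    rw [hGval]
    exact h x l hl v s
  -- K2 + APEX: `Rm(X,Y,Y,X) = -saddleForm ≤ 0`, hence `sec ≤ 0`
  have hsec : ∀ cov, G.IsLeviCivita cov →
      ∀ (x : W) (X Y : TangentSpace (𝓡 5) x), G.sectionalCurvature cov x X Y ≤ 0 := by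
    intro cov hcov w X Y
    obtain ⟨hXX, hXY, hYY, nXX, nXY, nYY, hgauss⟩ :=
      stub_hellingerGaussEquation S.carrier g hg W (hellinger ι) hθ G hG hGval cov hcov w X Y
    have hsd : 0 ≤ saddleForm g hg hXX hXY hYY := hSD w X Y hXX hXY hYY nXX nXY nYY
    have hRm : G.curvatureForm cov w X Y Y X ≤ 0 := by rw [hgauss]; linarith
    have hden : 0 ≤ G.val w X X * G.val w Y Y - G.val w X Y ^ 2 :=
      gram_nonneg (G.val w) (G.symm w) (fun v ↦ by
        by_cases hv : v = 0
        · subst hv; simp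
        · exact (hG w v hv).le) X Y
    rw [PseudoRiemannianMetric.sectionalCurvature]
    exact div_nonpos_iff.2 (Or.inr ⟨hRm, hden⟩)
  -- T: completeness and simple connectivity of the connected `sec ≤ 0` model with its collar
  obtain ⟨hcpt, hsc⟩ := stub_collarEndHadamard S g hg W G hG c Φ hc hsec hsm hinj hco hcl hasym
  exact ⟨g, hg, W, i₁, i₂, i₃, i₄, i₅, hsc, G, hG, c, Φ, hc, hcpt, hsec, hsm, hinj, hco, hcl, hasym⟩

end Summit.SmoothPoincare4.SmoothPoincare4.Cruxes.AhHadamardFilling.FisherSphereGauss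

end
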